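import Literature.MathematicalPhysics.QuantumFieldTheory.King1986.CompositionRate
import HarnessLib

/-!
# King 1986 II, Appendix B (B.9)–(B.11): the free lattice Laplacian symbol of spacing `η` on a ROTATED
lattice agrees with the axis-lattice symbol at the same physical momentum up to `O(η²|p|⁴)`, and the
inverse symbols up to `O(η²)` uniformly on the Brillouin zone — the linear-theory core of King's
two-scheme (rotated first averaging step vs axis scheme) uniqueness theorem on the torus

CITATION HEADER (lean-in-tree rule 2026-08-18).  PUBLISHED source, OUTSIDE the Bałaban series under audit
in cell `pub-balaban`: C. King, *The U(1) Higgs model. II. The infinite volume limit*, Commun. Math. Phys.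
**103** (1986) 323–349 [King1986II], Appendix B pp. 347–349 (renders
`HOME/t4/b2b-balaban-t4-lit2/g7/renders/1986-cmp103-king-u1-higgs-II-p025/p026/p027-x2.png` read as images
by the vendoring seat).  Quoted from p. 348: *"So we need only prove convergence of
(Δ^{(k)}(p′)⁻¹ − Δ̂^{(k)}(p′)⁻¹). This is done by comparing similar terms in (B.6) and (B.7). We will use
μ, α to denote components taken with respect to ηẐ^d, ηℤ^d. Then
Δ̂^η(p′+l′) = 4η⁻² Σ_μ sin²[½η(p′+l′)_μ] + m²(L^kε)², Δ^η(p′+l′) = 4η⁻² Σ_α sin²[½η(p′+l′)_α] + m²(L^kε)².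
(B.9) Using x² ≥ sin²x ≥ x² − ⅓x⁴, we get |Δ̂^η(p′+l′) − Δ^η(p′+l′)| ≤ CL^{−2k}[(p′+l′)²]². (B.10) Hence we
deduce |Δ̂^η(p+l′)⁻¹ − Δ^η(p′+l′)⁻¹| ≤ CL^{−2k}. (B.11)"* and p. 349: *"Combining these estimates with the
results obtained in Sect. 4 of [K1], we deduce |Δ̂^{(k)}(p′) − Δ^{(k)}(p′)| ≤ CL^{−2k}Δ^{(k)}(p′), (B.13)
which is the required result."*  Here `ηẐ^d` is the lattice rotated by `θ₀ = tan⁻¹(3/4)` (King II p. 326,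
Fig. 1; `L = 5`), `ηℤ^d` the axis lattice, and `μ` / `α` index the components of ONE momentum vector in the
two orthonormal frames — so `Σ_μ (p′+l′)_μ² = Σ_α (p′+l′)_α²`.  The companion paper C. King, *The U(1)
Higgs model. I*, CMP **102** (1986) 649–677 [King1986] supplies (4.7)/(4.10) p. 671, already in the tree as
`King1986.latticeSymbol_le`, `latticeSymbol_ge_quartic`, `latticeSymbol_inv_sub_ref_le'`
(`EffectiveLaplacianRate`, `CompositionRate`).

WHAT IS REPRODUCED (kernel, [folklore] algebra over the tree's typed symbol `King1986.latticeSymbol η M p =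
Σ_μ 4η⁻² sin²(½ηp_μ) + M`): for two coordinate vectors `p : d → ℝ`, `q : d' → ℝ` of EQUAL Euclidean
length (`momSq p = momSq q` — the components of one momentum in two orthonormal frames; the frames may
even have different index types) inside the respective Brillouin zones `|ηp_μ| ≤ π`, `|ηq_α| ≤ π`:
 * `latticeSymbol_sub_latticeSymbol_le` — (B.10) with explicit constant:
   `|Δ^η(p) − Δ^η(q)| ≤ (η²/12)(Σ_μ p_μ⁴ + Σ_α q_α⁴)`, and `…_le'`: `≤ (η²/6)|p|⁴`;
 * `latticeSymbol_inv_sub_inv_le` — (B.11) with explicit constant, uniformly on the zone and for every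
   mass `M ≥ 0`: `|Δ^η(p)⁻¹ − Δ^η(q)⁻¹| ≤ (π²/24) η²` (King: `CL^{−2k}`, `η = L^{−k}`).
So the free lattice propagator's symbol is ROTATION-COVARIANT UP TO `O(η²)`: it depends on the momentum
only through `|p|²` modulo the printed rate.  (B.13) (the averaged effective Laplacians `Δ̂^{(k)}` vs
`Δ^{(k)}`) is stated by King BY REFERENCE to §4 of [K1] and is NOT reproduced here; nor is (B.12).

HONEST FRAMING.  This is the A = 0, free, flat-lattice statement King prints and proves; it is NOT a
statement about Bałaban's covariant propagators, and the cell's T⁴ node COV2 (continuous rotations) is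
OFF-SPINE («in every printed treatment continuum rotation invariance is downstream of a scheme-independence
statement», `t4/T4-DAG.md` §2 COV2).  Value = a published, proved two-scheme symbol estimate made
kernel-checkable in the tree's vocabulary; NOT summit progress (finite torus, linear theory; nothing here is
infinite volume, a mass gap or the Clay problem).
-/

open Finset Real

namespace Literature.MathematicalPhysics.QuantumFieldTheory.King1986.RotatedSchemeSymbol

open Literature.MathematicalPhysics.QuantumFieldTheory.King1986

variable {d d' : Type*} [Fintype d] [Fintype d']

/-- **(B.10) with explicit constant.**  Two lattice Laplacian symbols of the same spacing `η` and mass `M`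
at coordinate vectors `p`, `q` of equal Euclidean length, both in the Brillouin zone:
`|Δ^η(p) − Δ^η(q)| ≤ (η²/12)(Σ_μ p_μ⁴ + Σ_α q_α⁴)` (both symbols lie in
`[|p|² + M − (η²/12)Σ(·)⁴, |p|² + M]` by King I (4.10)). [cite: King1986II, (B.9)–(B.10) p.348] -/
theorem latticeSymbol_sub_latticeSymbol_le {η : ℝ} (hη : η ≠ 0) (M : ℝ) {p : d → ℝ} {q : d' → ℝ}
    (hp : ∀ μ, |η * p μ| ≤ π) (hq : ∀ α, |η * q α| ≤ π) (hpq : momSq p = momSq q) :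
    |latticeSymbol η M p - latticeSymbol η M q|
      ≤ η ^ 2 / 12 * (∑ μ, p μ ^ 4 + ∑ α, q α ^ 4) := by
  have up := latticeSymbol_le hη M p
  have uq := latticeSymbol_le hη M q
  have lp := latticeSymbol_ge_quartic hη M hp
  have lq := latticeSymbol_ge_quartic hη M hq
  have h4p : 0 ≤ ∑ μ, p μ ^ 4 := Finset.sum_nonneg fun _ _ => by positivity
  have h4q : 0 ≤ ∑ α, q α ^ 4 := Finset.sum_nonneg fun _ _ => by positivity
  have hη2 : 0 ≤ η ^ 2 / 12 := by positivity
  rw [hpq] at up lp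
  rw [abs_sub_le_iff]
  constructor <;> nlinarith [mul_nonneg hη2 h4p, mul_nonneg hη2 h4q]

/-- (B.10) in King's form `≤ C η² [p²]²`, with `C = 1/6`: `|Δ^η(p) − Δ^η(q)| ≤ (η²/6)|p|⁴`
(`Σ_μ p_μ⁴ ≤ |p|⁴`, King I (4.10)). [cite: King1986II, (B.10) p.348] -/
theorem latticeSymbol_sub_latticeSymbol_le' {η : ℝ} (hη : η ≠ 0) (M : ℝ) {p : d → ℝ} {q : d' → ℝ}
    (hp : ∀ μ, |η * p μ| ≤ π) (hq : ∀ α, |η * q α| ≤ π) (hpq : momSq p = momSq q) :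
    |latticeSymbol η M p - latticeSymbol η M q| ≤ η ^ 2 / 6 * momSq p ^ 2 := by
  have h := latticeSymbol_sub_latticeSymbol_le hη M hp hq hpq
  have hp4 := sum_pow_four_le_momSq_sq p
  have hq4 := sum_pow_four_le_momSq_sq q
  rw [← hpq] at hq4
  have hη2 : 0 ≤ η ^ 2 / 12 := by positivity
  calc |latticeSymbol η M p - latticeSymbol η M q|
      ≤ η ^ 2 / 12 * (∑ μ, p μ ^ 4 + ∑ α, q α ^ 4) := h
    _ ≤ η ^ 2 / 12 * (momSq p ^ 2 + momSq p ^ 2) := by gcongr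
    _ = η ^ 2 / 6 * momSq p ^ 2 := by ring

/-- **(B.11) with explicit constant**, uniformly on the Brillouin zone and in the mass `M ≥ 0`:
`|Δ^η(p)⁻¹ − Δ^η(q)⁻¹| ≤ (π²/24) η²` for coordinate vectors of equal length — the inverse free lattice
Laplacian symbol is rotation-covariant up to `O(η²)` (King: "`≤ CL^{−2k}`", `η = L^{−k}`).  Proof: both
inverses are within `(π²/48)η²` of the common reference `(|p|² + M)⁻¹` (King I (4.7),
`latticeSymbol_inv_sub_ref_le'`). [cite: King1986II, (B.11) p.348] -/
theorem latticeSymbol_inv_sub_inv_le {η : ℝ} (hη : η ≠ 0) {M : ℝ} (hM : 0 ≤ M) {p : d → ℝ} {q : d' → ℝ}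
    (hp : ∀ μ, |η * p μ| ≤ π) (hq : ∀ α, |η * q α| ≤ π) (hpq : momSq p = momSq q) :
    |(latticeSymbol η M p)⁻¹ - (latticeSymbol η M q)⁻¹| ≤ π ^ 2 / 24 * η ^ 2 := by
  have h1 := latticeSymbol_inv_sub_ref_le' hη hM hp
  have h2 := latticeSymbol_inv_sub_ref_le' hη hM hq
  rw [← hpq] at h2
  calc |(latticeSymbol η M p)⁻¹ - (latticeSymbol η M q)⁻¹|
      ≤ |(latticeSymbol η M p)⁻¹ - (momSq p + M)⁻¹| + |(momSq p + M)⁻¹ - (latticeSymbol η M q)⁻¹| :=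
        abs_sub_le _ _ _
    _ = |(latticeSymbol η M p)⁻¹ - (momSq p + M)⁻¹| + |(latticeSymbol η M q)⁻¹ - (momSq p + M)⁻¹| := by
        rw [abs_sub_comm ((momSq p + M)⁻¹)]
    _ ≤ π ^ 2 / 48 * η ^ 2 + π ^ 2 / 48 * η ^ 2 := add_le_add h1 h2
    _ = π ^ 2 / 24 * η ^ 2 := by ring

/-- The two-scheme constant `π²/24 < 1/2` (numerical size of (B.11)'s `C` in `η`-units). [folklore] -/
theorem twoScheme_const_lt_half : π ^ 2 / 24 < (1 : ℝ) / 2 := by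
  have := Real.pi_lt_d2  -- π < 3.15
  nlinarith [Real.pi_pos]

end Literature.MathematicalPhysics.QuantumFieldTheory.King1986.RotatedSchemeSymbol
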